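import Summits.QuantumFields.BalabanUV.Beta.FP.DressedEntryWeightAlgebra
import Literature.MathematicalPhysics.QuantumFieldTheory.Balaban1983to89.Beta.StepDriftWitness
import Literature.MathematicalPhysics.QuantumFieldTheory.Balaban1983to89.Beta.OneStepKernelFamily

/-!
# `BalabanUV.Beta.FP.DressedEntryWardInvariance` — road «FP», binder row D1, ROUTE T, the (H5-F) option (3a) (road `g61/JUNCTION-F.md` §2 (e) «(W-TR)»;
# an2 g85 W-2 §10 THE RULE): **THE DRESSED KERNEL IS INVARIANT UNDER A PURE-GAUGE SHIFT OF ITS WEIGHT WHEN THE TABLE IS TWO-LEG TRANSVERSE** —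
# `hWT` (the ONE displayed (H5-F) junction of the END under (3a), dressing-invariance form) DERIVED from (i) the weight difference being a lattice
# gradient on every fine bond leg and (ii) the Ward co-closedness of the table on both legs

WHY (journal an2 g85 W-2 l.69183 §9a∕§10; road A-4 l.69160; an2 RCPT-4 l.69153 (3a)).  Under (3a) the END's F-family is dressed by the true top-step response weight `wF`
(an2 PART 96 `wFRec`), and the END consumer's `htr ∕ hF₁` (literal: `dressedEntry (wStep Lc (j+1)) 𝒯_j`) follow from road `TowerFTransportRowW ∕ TowerFAnchorRowW` at `w := wF` up to
ONE displayed junction per storey, `hWT : dressedEntry (wF j) 𝒯_j (Lc•z) μ ν = dressedEntry (wStep Lc (j+1)) 𝒯_j (Lc•z) μ ν`.  By value (Engine C R-AN2-84-HQF0) `wF − 3⁻⁵•wStep`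
is an EXACT pure gauge mode `dξ`; the structural content of `hWT` is therefore the one-loop WARD TRANSVERSALITY of the composite kernel `𝒯_j` (it kills exact 1-forms on each
leg).  THIS FILE is the [folklore] implication and nothing else: for weights `w, w₀ : EKer d` with `w c a u − w₀ c a u = ξ a (u + e_c) − ξ a u` (a forward lattice gradient of a
potential `ξ a` on every fine bond `(c, u)`, for every coarse source `a`) and a table `T : EKer d` whose leg-1 BACKWARD divergence and leg-2 FORWARD divergence vanish
(`Σ_c (T c e z − T c e (z − e_c)) = 0`, `Σ_e (T c e (z + e_e) − T c e z) = 0` — the two legs of `dressedSum`'s `T (y + u − x)` carry opposite signs), `dressedEntry w T = dressedEntry w₀ T`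
pointwise.  PROOF: road `DressedEntryWeightAlgebra` — the four-term expansion `dressedEntry_add_weight` at `w = w₀ + g`, the two cross terms and the pure `g` term each a sum of
`sum_dressedSum_grad_left_eq_zero ∕ sum_dressedSum_grad_right_eq_zero` after one `Finset.sum_comm`.

WHAT ([folklore] `tsum`∕`Finset` bookkeeping BY NAME; no `def`, no `def … : Prop`, nothing cited, 0 sorry): §1 (any `d`) `absMoment₂_grad`, **`dressedEntry_eq_of_grad_of_coclosed`**;
§2 (d = 4, the END's shape) **`hWT_of_grad_of_coclosed`** — `∀ j μ ν z, dressedEntry (wF j) (𝒯 j) ((Lc:ℤ)•z) μ ν = dressedEntry (w₀ j) (𝒯 j) ((Lc:ℤ)•z) μ ν` from the storey-indexed letters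
`hgauge hdivL hdivR` (+ `AbsMoment₂` of `w₀ j`, `ξ j`, `𝒯 j`); at `w₀ j := wStep Lc (j+1)`, `𝒯 j := hessKer (AN Rt j) (VN Rt P j) (WN Rt P j)` this is the END's `hWT` with the junction
REPLACED by its two structural halves — `hgauge` ((J-W″)'s «response = column + gradient», by value HQF0 γ ≤ 3.4e−14) and `hdivL hdivR` (Ward, by value R-FP-62-WARD, filed with this
file) — each DISPLAYED where used, none claimed here.
WHAT THIS IS NOT: not a proof that any kernel of the tower is transverse, nor that `wFRec − 3⁻⁵•wStep` is a gradient by name; not the weight `wFRec` (an2 PART 96); nothing of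
Bałaban's asserted, valued or discharged; 0 estimates; 0∕4 row-D1 binders (hW, hR, D1Tel, D1Rep); NOT (C1), NOT (T-ID), NOT D1, NEVER «G-an2-4 closed», NOT BetaPertH, NOT continuum,
NOT Clay.

HONEST DEPENDENCY (page 1, mandatory): continuum YM on T⁴ ⇐ BetaPertH ∧ nine spine estimates (0/9 proved); BetaPertH ⇐ (D1) ∧ (D4) ∧ CAP+tail;
G-an2-4 gates asym, D1 and NE2/3/4.  HONEST FRAMING (cell contract, verbatim): «discharging `BetaPertH` makes Bałaban's UV stability UNCONDITIONAL —
a real constructive-QFT result; it is NOT the continuum limit and NOT the Clay problem.»  ABSOLUTE RULE (cell charter, verbatim): «No internally-minted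
statement may enter as a cited fact. Every hypothesis is either kernel-proved in this package or a verbatim quotation of a PUBLISHED theorem with page
reference. The manuscript(s) under audit are NOT citable for their own disputed steps — they are the thing under adjudication; programme-internal
(2001/route/tribunal) claims are never citable.»  Road «FP» OWNER, b2b-balaban-beta-d1-p3 gen 62, 2026-08-30.  No existing file touched.
-/

noncomputable section

open scoped BigOperators

namespace Summit.QuantumFields.BalabanUV.Beta.FP.DressedEntryWardInvariance

open Finset
open Literature.MathematicalPhysics.QuantumFieldTheory.Balaban1983to89.Beta
open Literature.MathematicalPhysics.QuantumFieldTheory.Balaban1983to89.Beta.DecimatedMomentSummable (dressedSum AbsMoment₂)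
open Literature.MathematicalPhysics.QuantumFieldTheory.Balaban1983to89.Beta.DressedMomentNormalisation (EKer dressedEntry)
open Literature.MathematicalPhysics.QuantumFieldTheory.Balaban1983to89.Beta.StepDriftWitness (absMoment₂_sub_gen)
open Summit.QuantumFields.BalabanUV.Beta.FP.DressedEntryWeightAlgebra (dressedEntry_add_weight sum_dressedSum_grad_left_eq_zero
  sum_dressedSum_grad_right_eq_zero)

variable {d : ℕ}

/-! ## §1 A pure-gauge shift of the weight is invisible to a two-leg transverse table (any dimension) -/

/-- [folklore] the gradient weight `u ↦ w c a u − w₀ c a u` has an absolutely summable second moment when both weights do. -/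
theorem absMoment₂_grad {w w₀ : EKer d} (hw : ∀ κ l, AbsMoment₂ (w κ l)) (h₀ : ∀ κ l, AbsMoment₂ (w₀ κ l)) (κ l : Fin d) :
    AbsMoment₂ (fun u => w κ l u - w₀ κ l u) :=
  absMoment₂_sub_gen (hw κ l) (h₀ κ l)

/-- [folklore] **`dressedEntry_eq_of_grad_of_coclosed` — WARD INVARIANCE OF THE DRESSED KERNEL UNDER A PURE-GAUGE SHIFT OF THE WEIGHT.**
If `w − w₀` is, on every fine bond `(c, u)` and for every coarse source `a`, the forward lattice gradient of a potential `ξ a`, and the table `T` has vanishing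
leg-1 backward divergence and vanishing leg-2 forward divergence, then dressing `T` by `w` or by `w₀` gives the same kernel:
`dressedEntry w T y a b = dressedEntry w₀ T y a b`.  (Four-term expansion at `w = w₀ + (w − w₀)`; every term carrying the gradient is killed by
`sum_dressedSum_grad_left_eq_zero` ∕ `sum_dressedSum_grad_right_eq_zero`.) -/
theorem dressedEntry_eq_of_grad_of_coclosed (w w₀ T : EKer d) (ξ : Fin d → (Fin d → ℤ) → ℝ)
    (hw : ∀ κ l, AbsMoment₂ (w κ l)) (h₀ : ∀ κ l, AbsMoment₂ (w₀ κ l)) (hξ : ∀ a, AbsMoment₂ (ξ a)) (hT : ∀ c e, AbsMoment₂ (T c e))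
    (hgauge : ∀ (c a : Fin d) (u : Fin d → ℤ), w c a u - w₀ c a u = ξ a (u + Pi.single c 1) - ξ a u)
    (hdivL : ∀ (e : Fin d) (z : Fin d → ℤ), ∑ c, (T c e z - T c e (z - Pi.single c 1)) = 0)
    (hdivR : ∀ (c : Fin d) (z : Fin d → ℤ), ∑ e, (T c e (z + Pi.single e 1) - T c e z) = 0)
    (y : Fin d → ℤ) (a b : Fin d) :
    dressedEntry w T y a b = dressedEntry w₀ T y a b := by
  -- the gradient part `g := w − w₀` and its letters
  set g : EKer d := fun κ l u => w κ l u - w₀ κ l u with hg_def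
  have hg : ∀ κ l, AbsMoment₂ (g κ l) := fun κ l => absMoment₂_grad hw h₀ κ l
  have hgξ : ∀ (c a : Fin d) (u : Fin d → ℤ), g c a u = ξ a (u + Pi.single c 1) - ξ a u := fun c a u => hgauge c a u
  have hw_eq : w = fun κ l u => w₀ κ l u + g κ l u := by
    funext κ l u
    simp only [hg_def]
    ring
  -- the three gradient-carrying sums vanish
  have hleft : ∀ w' : Fin d → (Fin d → ℤ) → ℝ, (∀ e, AbsMoment₂ (w' e)) →
      ∑ c, ∑ e, dressedSum (g c a) (T c e) (w' e) y = 0 := by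
    intro w' hw'
    rw [Finset.sum_comm]
    refine Finset.sum_eq_zero fun e _ => ?_
    exact sum_dressedSum_grad_left_eq_zero (hξ a) (hw' e) (T := fun c => T c e) (g := fun c => g c a)
      (fun c => hT c e) (fun c => hg c a) (fun c u => hgξ c a u) (fun z => hdivL e z) y
  have hright : ∑ c, ∑ e, dressedSum (w₀ c a) (T c e) (g e b) y = 0 := by
    refine Finset.sum_eq_zero fun c _ => ?_
    exact sum_dressedSum_grad_right_eq_zero (h₀ c a) (hξ b) (T := fun e => T c e) (g := fun e => g e b)
      (fun e => hT c e) (fun e => hg e b) (fun e x => hgξ e b x) (fun z => hdivR c z) y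
  have hpure : dressedEntry g T y a b = 0 := by
    unfold dressedEntry
    exact hleft (fun e => g e b) (fun e => hg e b)
  rw [hw_eq, dressedEntry_add_weight w₀ g T h₀ hg hT y a b, hpure, hright, hleft (fun e => w₀ e b) (fun e => h₀ e b)]
  ring

/-! ## §2 The END's junction shape (d = 4): `hWT` from the storey-indexed letters `hgauge hdivL hdivR` -/

/-- [folklore] **`hWT_of_grad_of_coclosed` — THE (3a) JUNCTION `hWT` FROM ITS TWO STRUCTURAL HALVES**, storey by storey: for weight families `wF w₀ : ℕ → EKer 4`
(the END: `wF j := wFRec … j` re-indexed, `w₀ j := wStep Lc (j+1)`) with `wF j − w₀ j` a fine lattice gradient of `ξ j a` (`hgauge`), and tables `𝒯 : ℕ → EKer 4`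
(the END: `𝒯 j := hessKer (AN Rt j) (VN Rt P j) (WN Rt P j)`, resp. `TshotOf … 1` at the anchor) two-leg transverse (`hdivL hdivR`), the dressed kernels agree at every
coarse point `(Lc:ℤ)•z` — the text of `hWT` with `dressedEntry (w₀ j)` on the right. -/
theorem hWT_of_grad_of_coclosed (Lc : ℕ) (wF w₀ 𝒯 : ℕ → EKer 4) (ξ : ℕ → Fin 4 → (Fin 4 → ℤ) → ℝ)
    (hwF : ∀ j κ l, AbsMoment₂ (wF j κ l)) (hw₀ : ∀ j κ l, AbsMoment₂ (w₀ j κ l)) (hξ : ∀ j a, AbsMoment₂ (ξ j a))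
    (h𝒯 : ∀ j c e, AbsMoment₂ (𝒯 j c e))
    (hgauge : ∀ j (c a : Fin 4) (u : Fin 4 → ℤ), wF j c a u - w₀ j c a u = ξ j a (u + Pi.single c 1) - ξ j a u)
    (hdivL : ∀ j (e : Fin 4) (z : Fin 4 → ℤ), ∑ c, (𝒯 j c e z - 𝒯 j c e (z - Pi.single c 1)) = 0)
    (hdivR : ∀ j (c : Fin 4) (z : Fin 4 → ℤ), ∑ e, (𝒯 j c e (z + Pi.single e 1) - 𝒯 j c e z) = 0) :
    ∀ (j : ℕ) (μ ν : Fin 4) (z : Fin 4 → ℤ),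
      dressedEntry (wF j) (𝒯 j) ((Lc : ℤ) • z) μ ν = dressedEntry (w₀ j) (𝒯 j) ((Lc : ℤ) • z) μ ν :=
  fun j μ ν z => dressedEntry_eq_of_grad_of_coclosed (wF j) (w₀ j) (𝒯 j) (ξ j) (hwF j) (hw₀ j) (hξ j) (h𝒯 j)
    (hgauge j) (hdivL j) (hdivR j) ((Lc : ℤ) • z) μ ν

end Summit.QuantumFields.BalabanUV.Beta.FP.DressedEntryWardInvariance

end

/-!
# v2 APPEND (road FP g62, 2026-08-30; §1–§2 above = v1 p754900 BYTE-IDENTICAL) — THE (J-W″)∕HQF0 ORIENTATION AND THE PRINTED TABLE LETTERS (FINDING FP-70 (a))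

WHY.  an2 PART 96 `TowerFWeightRecDefs.wF … n c μ p := wFRec … n μ 0 c (−p)` packages the true weight exactly as lit `stepCol Lc j κ l p := KInvStep Lc j (−p) 0 …` does:
`dressedEntry`'s weight variable `u` is MINUS the fine position.  The gauge mode of (J-W″)∕A2-HQF0 is a lattice gradient `dz` (lit `AffineAveraging.dz f κ x = f (x + e_κ) − f x`,
FORWARD in position), so in the weight variable it is the BACKWARD difference `ζ (u − e_c) − ζ u` (`ζ u := ξ (−u)`), NOT §1's forward form.  The table letter that kills a
backward-gradient LEFT weight is FORWARD first-index co-closedness `Σ_c (T c e (z + e_c) − T c e z) = 0` — which is EXACTLY the printed Ward identity (5.9) in the `hessKer`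
convention, lit `PolarizationSign.WardTransversal (flipK T)` (`OneStepKernelFamily.wardTransversal_flipK_iff`, lead RULING (R21)); the RIGHT leg needs BACKWARD second-index
co-closedness, which is the same identity read through the printed symmetry (5.8) `PolarizationSign.IndexSymmetric T` (`T c e z = T e c (−z)`).  For the END's anchor table
`𝒯_0 = TshotOf … 1 = TbalOf Js 0` BOTH predicates are tree theorems of the record literal (road `StepKernelWardDataRecord.wardRefl_JsB12CombShSym_an1TablesS2_pinned_of_locks`,
`Gaps/D1RecordIndexSymmetry.indexSymmetric_TbalOf_JsB12CombShSym`) — FINDING FP-70 (b); the anchor instance is the road's next file.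

WHAT (appended; [folklore]; no `def`, 0 sorry): §3 `sum_dressedSum_shiftDiff_left_eq_zero ∕ _right_eq_zero` (g61's two kills for an ARBITRARY shift family `s c` — g61's proofs with
`Pi.single c 1 ↦ s c`), `dressedEntry_eq_of_shiftGrad_of_coclosed` (the common engine); §4 `unitVec_eq_single`, `coclosed_fwd₁_of_wardTransversal_flipK`,
`coclosed_bwd₂_of_wardTransversal_flipK_of_indexSymmetric`, **`dressedEntry_eq_of_bgrad_of_coclosed`** (backward gauge; table forward-1 ∕ backward-2),
**`dressedEntry_eq_of_bgrad_of_wardTransversal`** (backward gauge; table letters = the two PRINTED predicates); §5 (d = 4, storey-indexed) **`hWT_of_bgrad_of_wardTransversal`** —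
the END's `hWT` from `hgauge j : wF j c a u − w₀ j c a u = ζ j a (u − e_c) − ζ j a u`, `hW j : WardTransversal (flipK (𝒯 j))`, `hS j : IndexSymmetric (𝒯 j)`.
NOT CLAIMED: as page 1.
-/

noncomputable section

open scoped BigOperators

namespace Summit.QuantumFields.BalabanUV.Beta.FP.DressedEntryWardInvariance

open Finset
open Literature.MathematicalPhysics.QuantumFieldTheory.Balaban1983to89
open Literature.MathematicalPhysics.QuantumFieldTheory.Balaban1983to89.Beta
open Literature.MathematicalPhysics.QuantumFieldTheory.Balaban1983to89.Beta.DecimatedMomentSummable (dressedSum AbsMoment₂ summable_dressed_fibre)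
open Literature.MathematicalPhysics.QuantumFieldTheory.Balaban1983to89.Beta.DressedMomentNormalisation (EKer dressedEntry)
open Literature.MathematicalPhysics.QuantumFieldTheory.Balaban1983to89.Beta.OneStepKernelFamily (flipK flipK_apply wardTransversal_flipK_iff)
open Literature.MathematicalPhysics.QuantumFieldTheory.Balaban1983to89.B6BondElimination (unitVec unitVec_apply)
open PolarizationSign (WardTransversal IndexSymmetric)
open Summit.QuantumFields.BalabanUV.Beta.FP.DressedEntryWeightAlgebra (dressedEntry_add_weight dressedSum_fwdDiff_left dressedSum_fwdDiff_right)

variable {d : ℕ}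

/-! ## §3 g61's two kills for an arbitrary shift family; the common engine -/

/-- [folklore] **`sum_dressedSum_shiftDiff_left_eq_zero`** — `DressedEntryWeightAlgebra.sum_dressedSum_grad_left_eq_zero` for an ARBITRARY shift family `s c`
(g61's proof with `Pi.single c 1 ↦ s c`): for `g c = φ (· + s c) − φ` and `Σ_c (T c z − T c (z − s c)) = 0` for every `z`, `Σ_c dressedSum (g c) (T c) w′ y = 0`. -/
theorem sum_dressedSum_shiftDiff_left_eq_zero {φ w' : (Fin d → ℤ) → ℝ} (hφ : AbsMoment₂ φ) (hw' : AbsMoment₂ w') {T g : Fin d → (Fin d → ℤ) → ℝ}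
    (s : Fin d → (Fin d → ℤ)) (hT : ∀ c, AbsMoment₂ (T c)) (hg : ∀ c, AbsMoment₂ (g c)) (hgφ : ∀ c u, g c u = φ (u + s c) - φ u)
    (hdiv : ∀ z, ∑ c, (T c z - T c (z - s c)) = 0) (y : Fin d → ℤ) :
    ∑ c, dressedSum (g c) (T c) w' y = 0 := by
  have hg' : ∀ c, g c = fun u => φ (u + s c) - φ u := fun c => funext (hgφ c)
  have hstep : ∀ c, dressedSum (g c) (T c) w' y = dressedSum φ (T c) w' (y - s c) - dressedSum φ (T c) w' y := by
    intro c
    have hΔ : AbsMoment₂ (fun u => φ (u + s c) - φ u) := hg' c ▸ hg c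
    rw [hg' c]
    exact dressedSum_fwdDiff_left (s c) hφ hΔ (hT c) hw' y
  simp only [hstep]
  unfold dressedSum
  have hS₁ : ∀ c, Summable (fun p : (Fin d → ℤ) × (Fin d → ℤ) => φ p.1 * T c ((y - s c) + p.1 - p.2) * w' p.2) :=
    fun c => summable_dressed_fibre hφ (hT c) hw' (y - s c)
  have hS₂ : ∀ c, Summable (fun p : (Fin d → ℤ) × (Fin d → ℤ) => φ p.1 * T c (y + p.1 - p.2) * w' p.2) :=
    fun c => summable_dressed_fibre hφ (hT c) hw' y
  have hsub : ∀ c, ∑' p : (Fin d → ℤ) × (Fin d → ℤ), φ p.1 * T c ((y - s c) + p.1 - p.2) * w' p.2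
      - ∑' p : (Fin d → ℤ) × (Fin d → ℤ), φ p.1 * T c (y + p.1 - p.2) * w' p.2
      = ∑' p : (Fin d → ℤ) × (Fin d → ℤ), φ p.1 * w' p.2 * (T c ((y - s c) + p.1 - p.2) - T c (y + p.1 - p.2)) := by
    intro c
    rw [← (hS₁ c).tsum_sub (hS₂ c)]
    exact tsum_congr fun p => by ring
  simp only [hsub]
  rw [← Summable.tsum_finsetSum (fun c _ => ((hS₁ c).sub (hS₂ c)).congr (fun p => by ring))]
  refine (tsum_congr fun p => ?_).trans tsum_zero
  rw [← Finset.mul_sum]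
  have hz := hdiv (y + p.1 - p.2)
  have hre : ∀ c, T c ((y - s c) + p.1 - p.2) = T c (y + p.1 - p.2 - s c) := fun c => by
    congr 1; abel
  simp only [hre]
  rw [show (∑ c, (T c (y + p.1 - p.2 - s c) - T c (y + p.1 - p.2))) = -(∑ c, (T c (y + p.1 - p.2) - T c (y + p.1 - p.2 - s c))) by
    rw [← Finset.sum_neg_distrib]; exact Finset.sum_congr rfl fun c _ => by ring, hz, neg_zero, mul_zero]

/-- [folklore] **`sum_dressedSum_shiftDiff_right_eq_zero`** — `DressedEntryWeightAlgebra.sum_dressedSum_grad_right_eq_zero` for an ARBITRARY shift family `s e`: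
for `g e = ψ (· + s e) − ψ` and `Σ_e (T e (z + s e) − T e z) = 0` for every `z`, `Σ_e dressedSum w (T e) (g e) y = 0`. -/
theorem sum_dressedSum_shiftDiff_right_eq_zero {w ψ : (Fin d → ℤ) → ℝ} (hw : AbsMoment₂ w) (hψ : AbsMoment₂ ψ) {T g : Fin d → (Fin d → ℤ) → ℝ}
    (s : Fin d → (Fin d → ℤ)) (hT : ∀ e, AbsMoment₂ (T e)) (hg : ∀ e, AbsMoment₂ (g e)) (hgψ : ∀ e x, g e x = ψ (x + s e) - ψ x)
    (hdiv : ∀ z, ∑ e, (T e (z + s e) - T e z) = 0) (y : Fin d → ℤ) :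
    ∑ e, dressedSum w (T e) (g e) y = 0 := by
  have hg' : ∀ e, g e = fun x => ψ (x + s e) - ψ x := fun e => funext (hgψ e)
  have hstep : ∀ e, dressedSum w (T e) (g e) y = dressedSum w (T e) ψ (y + s e) - dressedSum w (T e) ψ y := by
    intro e
    have hΔ : AbsMoment₂ (fun x => ψ (x + s e) - ψ x) := hg' e ▸ hg e
    rw [hg' e]
    exact dressedSum_fwdDiff_right (s e) hw (hT e) hψ hΔ y
  simp only [hstep]
  unfold dressedSum
  have hS₁ : ∀ e, Summable (fun p : (Fin d → ℤ) × (Fin d → ℤ) => w p.1 * T e ((y + s e) + p.1 - p.2) * ψ p.2) :=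
    fun e => summable_dressed_fibre hw (hT e) hψ (y + s e)
  have hS₂ : ∀ e, Summable (fun p : (Fin d → ℤ) × (Fin d → ℤ) => w p.1 * T e (y + p.1 - p.2) * ψ p.2) :=
    fun e => summable_dressed_fibre hw (hT e) hψ y
  have hsub : ∀ e, ∑' p : (Fin d → ℤ) × (Fin d → ℤ), w p.1 * T e ((y + s e) + p.1 - p.2) * ψ p.2
      - ∑' p : (Fin d → ℤ) × (Fin d → ℤ), w p.1 * T e (y + p.1 - p.2) * ψ p.2
      = ∑' p : (Fin d → ℤ) × (Fin d → ℤ), w p.1 * ψ p.2 * (T e ((y + s e) + p.1 - p.2) - T e (y + p.1 - p.2)) := by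
    intro e
    rw [← (hS₁ e).tsum_sub (hS₂ e)]
    exact tsum_congr fun p => by ring
  simp only [hsub]
  rw [← Summable.tsum_finsetSum (fun e _ => ((hS₁ e).sub (hS₂ e)).congr (fun p => by ring))]
  refine (tsum_congr fun p => ?_).trans tsum_zero
  rw [← Finset.mul_sum]
  have hz := hdiv (y + p.1 - p.2)
  have hre : ∀ e, T e ((y + s e) + p.1 - p.2) = T e (y + p.1 - p.2 + s e) := fun e => by
    congr 1; abel
  simp only [hre]
  rw [hz, mul_zero]

/-- [folklore] the common engine of §2 and §3: a weight shift `w − w₀ = g` with `g c a = φ a (· + s c) − φ a` (ONE potential `φ a` per coarse source, ONE shift `s c` per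
fine direction) is invisible to `dressedEntry` against a table whose leg-1 `s`-backward and leg-2 `s`-forward divergences vanish. -/
theorem dressedEntry_eq_of_shiftGrad_of_coclosed (w w₀ T : EKer d) (φ : Fin d → (Fin d → ℤ) → ℝ) (s : Fin d → (Fin d → ℤ))
    (hw : ∀ κ l, AbsMoment₂ (w κ l)) (h₀ : ∀ κ l, AbsMoment₂ (w₀ κ l)) (hφ : ∀ a, AbsMoment₂ (φ a)) (hT : ∀ c e, AbsMoment₂ (T c e))
    (hgauge : ∀ (c a : Fin d) (u : Fin d → ℤ), w c a u - w₀ c a u = φ a (u + s c) - φ a u)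
    (hdivL : ∀ (e : Fin d) (z : Fin d → ℤ), ∑ c, (T c e z - T c e (z - s c)) = 0)
    (hdivR : ∀ (c : Fin d) (z : Fin d → ℤ), ∑ e, (T c e (z + s e) - T c e z) = 0)
    (y : Fin d → ℤ) (a b : Fin d) :
    dressedEntry w T y a b = dressedEntry w₀ T y a b := by
  -- the gradient part `g := w − w₀` and its letters
  set g : EKer d := fun κ l u => w κ l u - w₀ κ l u with hg_def
  have hg : ∀ κ l, AbsMoment₂ (g κ l) := fun κ l => absMoment₂_grad hw h₀ κ l
  have hgφ : ∀ (c a : Fin d) (u : Fin d → ℤ), g c a u = φ a (u + s c) - φ a u := fun c a u => hgauge c a u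
  have hw_eq : w = fun κ l u => w₀ κ l u + g κ l u := by
    funext κ l u
    simp only [hg_def]
    ring
  -- the three gradient-carrying sums vanish
  have hleft : ∀ w' : Fin d → (Fin d → ℤ) → ℝ, (∀ e, AbsMoment₂ (w' e)) →
      ∑ c, ∑ e, dressedSum (g c a) (T c e) (w' e) y = 0 := by
    intro w' hw'
    rw [Finset.sum_comm]
    refine Finset.sum_eq_zero fun e _ => ?_
    exact sum_dressedSum_shiftDiff_left_eq_zero (hφ a) (hw' e) (T := fun c => T c e) (g := fun c => g c a) s
      (fun c => hT c e) (fun c => hg c a) (fun c u => hgφ c a u) (fun z => hdivL e z) y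
  have hright : ∑ c, ∑ e, dressedSum (w₀ c a) (T c e) (g e b) y = 0 := by
    refine Finset.sum_eq_zero fun c _ => ?_
    exact sum_dressedSum_shiftDiff_right_eq_zero (h₀ c a) (hφ b) (T := fun e => T c e) (g := fun e => g e b) s
      (fun e => hT c e) (fun e => hg e b) (fun e x => hgφ e b x) (fun z => hdivR c z) y
  have hpure : dressedEntry g T y a b = 0 := by
    unfold dressedEntry
    exact hleft (fun e => g e b) (fun e => hg e b)
  rw [hw_eq, dressedEntry_add_weight w₀ g T h₀ hg hT y a b, hpure, hright, hleft (fun e => w₀ e b) (fun e => h₀ e b)]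
  ring

/-! ## §4 BACKWARD gauge (`ζ a (u − e_c) − ζ a u` — the (J-W″)∕HQF0 gauge mode read in `dressedEntry`'s weight variable `u = −x`): table FORWARD-co-closed in the
first index = the printed Ward identity `WardTransversal (flipK T)`, backward in the second = the same + `IndexSymmetric T` -/

/-- [folklore] `B6BondElimination.unitVec c` IS `Pi.single c 1`. -/
theorem unitVec_eq_single (c : Fin d) : unitVec c = Pi.single c (1 : ℤ) := by
  funext i
  rw [unitVec_apply, Pi.single_apply]

/-- [folklore] **the printed Ward identity (5.9) in the `hessKer` convention is FORWARD first-index co-closedness**: `WardTransversal (flipK T)` ⇒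
`Σ_c (T c e (z + e_c) − T c e z) = 0` (lit `OneStepKernelFamily.wardTransversal_flipK_iff`, `unitVec c = Pi.single c 1`). -/
theorem coclosed_fwd₁_of_wardTransversal_flipK {T : EKer d} (hW : WardTransversal (flipK T)) (e : Fin d) (z : Fin d → ℤ) :
    ∑ c, (T c e (z + Pi.single c 1) - T c e z) = 0 := by
  have h := (wardTransversal_flipK_iff T).1 hW e z
  simpa only [unitVec_eq_single] using h

/-- [folklore] **… and, with the printed symmetry (5.8) `IndexSymmetric T` (`T c e z = T e c (−z)`), BACKWARD second-index co-closedness**: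
`Σ_e (T c e (z − e_e) − T c e z) = 0` (the leg-1 identity at `(c, −z)` read through the index swap). -/
theorem coclosed_bwd₂_of_wardTransversal_flipK_of_indexSymmetric {T : EKer d} (hW : WardTransversal (flipK T)) (hS : IndexSymmetric T)
    (c : Fin d) (z : Fin d → ℤ) :
    ∑ e, (T c e (z - Pi.single e 1) - T c e z) = 0 := by
  have h := coclosed_fwd₁_of_wardTransversal_flipK hW c (-z)
  refine Eq.trans (Finset.sum_congr rfl fun e _ => ?_) h
  rw [hS c e (z - Pi.single e 1), hS c e z, show -(z - Pi.single e 1) = -z + Pi.single e 1 by abel]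

/-- [folklore] **`dressedEntry_eq_of_bgrad_of_coclosed`** — the §2 statement for the BACKWARD gauge form `w c a u − w₀ c a u = ζ a (u − e_c) − ζ a u` (shift family
`s c := −e_c`): the table must be FORWARD-co-closed in the first index and BACKWARD-co-closed in the second. -/
theorem dressedEntry_eq_of_bgrad_of_coclosed (w w₀ T : EKer d) (ζ : Fin d → (Fin d → ℤ) → ℝ)
    (hw : ∀ κ l, AbsMoment₂ (w κ l)) (h₀ : ∀ κ l, AbsMoment₂ (w₀ κ l)) (hζ : ∀ a, AbsMoment₂ (ζ a)) (hT : ∀ c e, AbsMoment₂ (T c e))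
    (hgauge : ∀ (c a : Fin d) (u : Fin d → ℤ), w c a u - w₀ c a u = ζ a (u - Pi.single c 1) - ζ a u)
    (hdiv₁ : ∀ (e : Fin d) (z : Fin d → ℤ), ∑ c, (T c e (z + Pi.single c 1) - T c e z) = 0)
    (hdiv₂ : ∀ (c : Fin d) (z : Fin d → ℤ), ∑ e, (T c e (z - Pi.single e 1) - T c e z) = 0)
    (y : Fin d → ℤ) (a b : Fin d) :
    dressedEntry w T y a b = dressedEntry w₀ T y a b := by
  refine dressedEntry_eq_of_shiftGrad_of_coclosed w w₀ T ζ (fun c => -Pi.single c 1) hw h₀ hζ hT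
    (fun c a u => by rw [hgauge c a u, ← sub_eq_add_neg]) (fun e z => ?_) (fun c z => ?_) y a b
  · -- leg 1: `Σ_c (T c e z − T c e (z − (−e_c))) = −Σ_c (T c e (z + e_c) − T c e z) = 0`
    have h := hdiv₁ e z
    rw [← neg_eq_zero, ← Finset.sum_neg_distrib] at h
    refine Eq.trans (Finset.sum_congr rfl fun c _ => ?_) h
    rw [sub_neg_eq_add, neg_sub]
  · -- leg 2: `Σ_e (T c e (z + (−e_e)) − T c e z) = Σ_e (T c e (z − e_e) − T c e z) = 0`
    refine Eq.trans (Finset.sum_congr rfl fun e _ => ?_) (hdiv₂ c z)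
    rw [← sub_eq_add_neg]

/-- [folklore] **`dressedEntry_eq_of_bgrad_of_wardTransversal` — WARD INVARIANCE OF THE DRESSED KERNEL, PRINTED PREDICATES.**  If `w − w₀` is a backward lattice
gradient of ONE potential per coarse source on every fine bond, and `T` satisfies the printed Ward identity `WardTransversal (flipK T)` ((5.9), `hessKer` convention) and
the printed symmetry `IndexSymmetric T` ((5.8)), then `dressedEntry w T = dressedEntry w₀ T` pointwise. -/
theorem dressedEntry_eq_of_bgrad_of_wardTransversal (w w₀ T : EKer d) (ζ : Fin d → (Fin d → ℤ) → ℝ)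
    (hw : ∀ κ l, AbsMoment₂ (w κ l)) (h₀ : ∀ κ l, AbsMoment₂ (w₀ κ l)) (hζ : ∀ a, AbsMoment₂ (ζ a)) (hT : ∀ c e, AbsMoment₂ (T c e))
    (hgauge : ∀ (c a : Fin d) (u : Fin d → ℤ), w c a u - w₀ c a u = ζ a (u - Pi.single c 1) - ζ a u)
    (hW : WardTransversal (flipK T)) (hS : IndexSymmetric T) (y : Fin d → ℤ) (a b : Fin d) :
    dressedEntry w T y a b = dressedEntry w₀ T y a b :=
  dressedEntry_eq_of_bgrad_of_coclosed w w₀ T ζ hw h₀ hζ hT hgauge (coclosed_fwd₁_of_wardTransversal_flipK hW)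
    (coclosed_bwd₂_of_wardTransversal_flipK_of_indexSymmetric hW hS) y a b

/-! ## §5 The END's junction shape (d = 4) in the (J-W″)∕HQF0 orientation -/

/-- [folklore] **`hWT_of_bgrad_of_wardTransversal`** (the (J-W″)∕HQF0 orientation, printed table letters) — for weight families `wF w₀ : ℕ → EKer 4` with
`wF j c a u − w₀ j c a u = ζ j a (u − e_c) − ζ j a u` (`hgauge`), and tables `𝒯 : ℕ → EKer 4` with `WardTransversal (flipK (𝒯 j))` (`hW`) and `IndexSymmetric (𝒯 j)` (`hS`),
`∀ j μ ν z, dressedEntry (wF j) (𝒯 j) ((Lc:ℤ)•z) μ ν = dressedEntry (w₀ j) (𝒯 j) ((Lc:ℤ)•z) μ ν` — the END's `hWT` at `w₀ j := wStep Lc (j+1)`. -/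
theorem hWT_of_bgrad_of_wardTransversal (Lc : ℕ) (wF w₀ 𝒯 : ℕ → EKer 4) (ζ : ℕ → Fin 4 → (Fin 4 → ℤ) → ℝ)
    (hwF : ∀ j κ l, AbsMoment₂ (wF j κ l)) (hw₀ : ∀ j κ l, AbsMoment₂ (w₀ j κ l)) (hζ : ∀ j a, AbsMoment₂ (ζ j a))
    (h𝒯 : ∀ j c e, AbsMoment₂ (𝒯 j c e))
    (hgauge : ∀ j (c a : Fin 4) (u : Fin 4 → ℤ), wF j c a u - w₀ j c a u = ζ j a (u - Pi.single c 1) - ζ j a u)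
    (hW : ∀ j, WardTransversal (flipK (𝒯 j))) (hS : ∀ j, IndexSymmetric (𝒯 j)) :
    ∀ (j : ℕ) (μ ν : Fin 4) (z : Fin 4 → ℤ),
      dressedEntry (wF j) (𝒯 j) ((Lc : ℤ) • z) μ ν = dressedEntry (w₀ j) (𝒯 j) ((Lc : ℤ) • z) μ ν :=
  fun j μ ν z => dressedEntry_eq_of_bgrad_of_wardTransversal (wF j) (w₀ j) (𝒯 j) (ζ j) (hwF j) (hw₀ j) (hζ j) (h𝒯 j)
    (hgauge j) (hW j) (hS j) ((Lc : ℤ) • z) μ ν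

end Summit.QuantumFields.BalabanUV.Beta.FP.DressedEntryWardInvariance

end
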